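import Summits.ValiantsHypothesis.ValiantsHypothesis.Theorems.MonotoneRestorationOrbitRestorationQPWaringSylvesterStratum
import HarnessLib

/-!
# A_∞ on the Sylvester stratum of ΣΛΣ, affine forms

Route MonotoneRestoration, crux `OrbitRestorationQP` (stmt-ValiantsHypothesis-18293), line `depth-three-rung`,
stub A_∞ `stub_sigmaPiSigmaValue`.  Namespace `Summit.ValiantsHypothesis.ValiantsHypothesis.Theorems.WaringJennrich`.

`…WaringSylvesterStratum.lean` treats powers of LINEAR forms.  Depth-3 powering gates use AFFINE forms
`ℓ_w + b`; as for the Jennrich stratum (`…WaringJennrichAffine.lean`) the constants are recovered from a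
second homogeneous component:

* `homogeneousComponent_affPow` — all homogeneous components of `a (ℓ_w + b)^d`;
* `sylvester_affine_terms` — **uniqueness for affine Waring decompositions in the Sylvester regime**:
  `Σ_{i<r} a_i (ℓ_{w_i} + b_i)^d = Σ_{j<r} a'_j (ℓ_{v_j} + b'_j)^d`, both families of linear parts nonzero and
  pairwise non-proportional, `a'_j ≠ 0`, `2r ≤ d + 1` ⇒ `ℓ_{v_j} + b'_j = c_j (ℓ_{w_{k_j}} + b_{k_j})` and
  `a'_j c_j^d = a_{k_j}` (top components: `sylvester_terms`; degree-`d-1` components and Sylvester's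
  independence in degree `d - 1` give the constants);
* `identifiable_of_nonproportional_affine`, `sigmaLambdaSigma_sylvester_restoration_affine` — **every
  matrix-symmetric family that is, at each level, a sum of `r` nonzero multiples of `d`-th powers of affine
  forms with nonzero pairwise non-proportional linear parts, `2r ≤ d + 1`, `r, d ≤ n^c₀ + c₀`, is
  quasi-polynomially orbit-restorable.**

Honest label: sub-rung of A_∞; A_∞ and the crux stay open; VP ≠ VNP untouched. [folklore; Sylvester]
-/

noncomputable section

open scoped Classical

-- `Summit.ValiantsHypothesis.ValiantsHypothesis.…` is the tree's single-conjunct layout (Sub = Summit).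
set_option linter.dupNamespace false

namespace Summit.ValiantsHypothesis.ValiantsHypothesis.Theorems

namespace WaringJennrich

open MvPolynomial Finset OrbitRestorationQPDepthThreeRung

universe u v

section General

variable {K : Type u} [Field K] {X : Type v} [Fintype X]

/-- **All homogeneous components of a scaled power of an affine form.** [folklore] -/
theorem homogeneousComponent_affPow (w : X → K) (b a : K) (d m : ℕ) (hm : m ≤ d) :
    homogeneousComponent m (C a * (lin w + C b) ^ d) =
      C (a * (b ^ (d - m) * (d.choose m : K))) * lin w ^ m := by
  rw [homogeneousComponent_C_mul, map_mul, mul_assoc]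
  congr 1
  rw [add_pow, map_sum]
  have hterm : ∀ m' : ℕ, lin w ^ m' * C b ^ (d - m') * (d.choose m' : MvPolynomial X K) =
      C (b ^ (d - m') * (d.choose m' : K)) * lin w ^ m' := fun m' => by
    rw [map_mul, map_pow, map_natCast]; ring
  have hhom : ∀ m' : ℕ, C (b ^ (d - m') * (d.choose m' : K)) * lin w ^ m' ∈ homogeneousSubmodule X K m' := by
    intro m'
    rw [mem_homogeneousSubmodule]
    have h1 : (lin w ^ m').IsHomogeneous m' := by simpa using (isHomogeneous_lin w).pow m'
    exact h1.C_mul _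
  rw [Finset.sum_congr rfl fun m' _ => by rw [hterm, homogeneousComponent_of_mem (hhom m')],
    Finset.sum_ite_eq, if_pos (Finset.mem_range.2 (Nat.lt_succ_of_le hm))]

/-- The degree-`d - 1` component of `a (ℓ_w + b)^d` is `a d b · ℓ_w^(d-1)`. [folklore] -/
theorem homogeneousComponent_sub_one_affPow (w : X → K) (b a : K) {d : ℕ} (hd : 1 ≤ d) :
    homogeneousComponent (d - 1) (C a * (lin w + C b) ^ d) = C (a * (d : K) * b) * lin w ^ (d - 1) := by
  rw [homogeneousComponent_affPow w b a d (d - 1) (Nat.sub_le d 1), Nat.sub_sub_self hd, pow_one,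
    ← Nat.choose_symm (Nat.sub_le d 1), Nat.sub_sub_self hd, Nat.choose_one_right]
  congr 2
  ring

variable [CharZero K] [Infinite K]

/-- **Sylvester uniqueness for affine Waring decompositions.** [folklore; Sylvester] -/
theorem sylvester_affine_terms {r d : ℕ} (w v : Fin r → X → K) (b b' a a' : Fin r → K)
    (hw0 : ∀ i, w i ≠ 0) (hnp : ∀ i i', i ≠ i' → ∀ c : K, w i ≠ c • w i')
    (hv0 : ∀ j, v j ≠ 0) (hnp' : ∀ j j', j ≠ j' → ∀ c : K, v j ≠ c • v j')
    (ha' : ∀ j, a' j ≠ 0) (hr : 2 * r ≤ d + 1)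
    (h : ∑ i, C (a i) * (lin (w i) + C (b i)) ^ d = ∑ j, C (a' j) * (lin (v j) + C (b' j)) ^ d)
    (j : Fin r) :
    ∃ (k : Fin r) (c : K), lin (v j) + C (b' j) = C c * (lin (w k) + C (b k)) ∧ a' j * c ^ d = a k := by
  -- top components: the linear Sylvester matching
  have htop := congrArg (homogeneousComponent d) h
  rw [map_sum, map_sum] at htop
  simp only [homogeneousComponent_top_affPow] at htop
  have hmatch := sylvester_terms w v a a' hw0 hnp hv0 hnp' ha' hr htop
  choose k c hkc hcoef using hmatch
  have hd : 1 ≤ d := by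
    have : 0 < r := Fin.pos j
    omega
  have hc0 : ∀ j, c j ≠ 0 := fun j h0 => hv0 j (by rw [hkc j, h0, zero_smul])
  have hinj : Function.Injective k := by
    intro j j' hjj'
    by_contra hne
    refine hnp' j' j (Ne.symm hne) (c j' / c j) ?_
    rw [hkc j, hkc j', hjj', smul_smul, div_mul_cancel₀ _ (hc0 j)]
  have hbij : Function.Bijective k := Finite.injective_iff_bijective.mp hinj
  let e : Fin r ≃ Fin r := Equiv.ofBijective k hbij
  -- degree `d - 1` components
  have hsub := congrArg (homogeneousComponent (d - 1)) h
  rw [map_sum, map_sum] at hsub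
  simp only [homogeneousComponent_sub_one_affPow _ _ _ hd] at hsub
  -- rewrite the right-hand side over the `w` via the bijection `k`
  have hR : ∑ j, C (a' j * (d : K) * b' j) * lin (v j) ^ (d - 1) =
      ∑ i, C (a' (e.symm i) * (d : K) * b' (e.symm i) * c (e.symm i) ^ (d - 1)) * lin (w i) ^ (d - 1) := by
    rw [← Equiv.sum_comp e (fun i => C (a' (e.symm i) * (d : K) * b' (e.symm i) * c (e.symm i) ^ (d - 1)) *
      lin (w i) ^ (d - 1))]
    refine Finset.sum_congr rfl fun j _ => ?_
    simp only [Equiv.symm_apply_apply]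
    rw [show e j = k j from rfl, hkc j, lin_smul, mul_pow, ← map_pow, ← mul_assoc, ← map_mul]
  rw [hR] at hsub
  -- compare coefficients by Sylvester's independence in degree `d - 1`
  have hind := linearIndependent_pow_of_nonproportional' (d := d - 1) w
    (by rw [Fintype.card_fin]; omega) hw0 hnp
  have hcoef2 : ∀ i, a i * (d : K) * b i = a' (e.symm i) * (d : K) * b' (e.symm i) * c (e.symm i) ^ (d - 1) := by
    rw [Fintype.linearIndependent_iff] at hind
    have hz := hind (fun i => a i * (d : K) * b i -
        a' (e.symm i) * (d : K) * b' (e.symm i) * c (e.symm i) ^ (d - 1)) (by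
      simp only [sub_smul, Finset.sum_sub_distrib, smul_eq_C_mul, sub_eq_zero]
      exact hsub)
    intro i
    exact sub_eq_zero.mp (hz i)
  refine ⟨k j, c j, ?_, hcoef j⟩
  have hi := hcoef2 (k j)
  rw [show e.symm (k j) = j from e.symm_apply_apply j, ← hcoef j] at hi
  -- `hi : a' j * c j ^ d * d * b (k j) = a' j * d * b' j * c j ^ (d - 1)`; cancel `a' j * d * c j ^ (d-1)`
  have hdK : (d : K) ≠ 0 := by exact_mod_cast (show d ≠ 0 by omega)
  have hb : b' j = c j * b (k j) := by
    have hne : a' j * (d : K) * c j ^ (d - 1) ≠ 0 :=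
      mul_ne_zero (mul_ne_zero (ha' j) hdK) (pow_ne_zero _ (hc0 j))
    refine mul_left_cancel₀ hne ?_
    have hpow : c j ^ d = c j ^ (d - 1) * c j := by rw [← pow_succ]; congr 1; omega
    rw [hpow] at hi
    linear_combination -hi
  rw [hkc j, lin_smul, hb, map_mul, mul_add]

end General

/-! ### The diagonal action and restorability -/

variable {n : ℕ}

/-- **The affine Sylvester stratum is identifiable along the group.** [folklore] -/
theorem identifiable_of_nonproportional_affine {r d : ℕ} (w : Fin r → (Fin n × Fin n) → ℂ)
    (b a : Fin r → ℂ) (hw0 : ∀ i, w i ≠ 0) (hnp : ∀ i i', i ≠ i' → ∀ c : ℂ, w i ≠ c • w i')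
    (ha : ∀ i, a i ≠ 0) (hr : 2 * r ≤ d + 1) (σ : Equiv.Perm (Fin n))
    (h : ∑ i, C (a i) * (lin (w i) + C (b i)) ^ d =
      ∑ j, C (a j) * (lin (fun x => w j (σ⁻¹ • x)) + C (b j)) ^ d) (j : Fin r) :
    ∃ (k : Fin r) (c : ℂ),
      lin (fun x => w j (σ⁻¹ • x)) + C (b j) = C c * (lin (w k) + C (b k)) ∧ a j * c ^ d = a k :=
  sylvester_affine_terms w (fun j => fun x => w j (σ⁻¹ • x)) b b a a hw0 hnp (ne_zero_perm σ hw0)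
    (nonproportional_perm σ hnp) ha hr h j

/-- **A_∞ ON THE AFFINE SYLVESTER STRATUM OF ΣΛΣ (family form).**  Every matrix-symmetric family `f` which
at every level `n` is a sum of `r ≤ n^c₀ + c₀` nonzero multiples of `d`-th powers, `2r ≤ d + 1`,
`1 ≤ d ≤ n^c₀ + c₀`, of affine forms with nonzero pairwise non-proportional linear parts is quasi-polynomially
orbit-restorable. [folklore] -/
theorem sigmaLambdaSigma_sylvester_restoration_affine (f : (n : ℕ) → MvPolynomial (Fin n × Fin n) ℂ)
    (hsym : IsMatrixSymmetric f)
    (h : ∃ c₀ : ℕ, ∀ n : ℕ, ∃ (r d : ℕ) (w : Fin r → (Fin n × Fin n) → ℂ) (b a : Fin r → ℂ),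
      1 ≤ d ∧ 2 * r ≤ d + 1 ∧ r ≤ n ^ c₀ + c₀ ∧ d ≤ n ^ c₀ + c₀ ∧ (∀ i, w i ≠ 0) ∧
        (∀ i i', i ≠ i' → ∀ c : ℂ, w i ≠ c • w i') ∧ (∀ i, a i ≠ 0) ∧
          f n = ∑ i, C (a i) * (lin (w i) + C (b i)) ^ d) :
    ∃ c : ℕ, ∀ n : ℕ, QPOrbitRestorable c n (f n) := by
  obtain ⟨c₀, hc₀⟩ := h
  obtain ⟨c, hc⟩ := sq_polyBound_le_qp c₀
  refine ⟨c + 5, fun n => ?_⟩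
  obtain ⟨r, d, w, b, a, hd, hr, hrle, hdle, hw0, hnp, ha, hf⟩ := hc₀ n
  refine qpOrbitRestorable_of_identifiableWaring w b a hd ha
    (identifiable_of_nonproportional_affine w b a hw0 hnp ha hr) ?_ hf
    (ValueOrbit.ren_eq_of_matrixSymmetric (hsym n))
  exact (Nat.mul_le_mul hrle hdle).trans (hc n)

end WaringJennrich

end Summit.ValiantsHypothesis.ValiantsHypothesis.Theorems

end
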